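import Literature.Combinatorics.Sahi2008.Functional

/-!
# Sahi (2008): symmetry of `E_n` under permutations of its arguments; the last-slot forms

CITATION HEADER.  Sources as in `Sahi2008/Functional.lean`: [Sahi2008] eqs. (4)–(7), Thm. 6; [LiebSahi2021]
Def. 3.1, Prop. 3.3.  What is reproduced: the fact — manifest in Sahi's set-partition / cycle-sum definition —
that `E_n(f_1,…,f_n)` is a SYMMETRIC function of `f_1,…,f_n`.  For the tree's definition of `sahiE` by the
Lieb–Sahi recursion (slot `0` peeled) symmetry is a theorem, proved here (`sahiE_comp_perm`); with it the
recursion and the branching identity are restated in Lieb–Sahi's / Sahi's verbatim slot order (distinguished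
function LAST): `sahiE_snoc` [LiebSahi2021, Prop. 3.3], `sahiE_snoc_one` [Sahi2008, Thm. 6].

PROOF ROUTE (ours; elementary).  (A) Permuting the tail slots: immediate from the recursion and symmetry one
level down (`sahiE_cons_comp_perm`).  (B) Swapping the two head slots: expand the recursion twice; the double sum
`Σ_{j,k} E(r with r_j ↦ r_j f_0, then slot k multiplied by f_1)` is symmetric under `(f_0, j) ↔ (f_1, k)` term by
term, and the remaining terms are visibly symmetric (`sahiE_cons_cons_comm`).  (C) Transpositions `(0 y)` are
conjugates `(1 y)(0 1)(1 y)`; every permutation is a product of transpositions (`Equiv.Perm.swap_induction_on`),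
induction on `n`.
-/

namespace Literature.Combinatorics.Sahi2008

open Finset Function

variable {α : Type*} [Fintype α]

/-! ### Tuple bookkeeping -/

/-- The recursion in `Fin.cons` form. [cite: LiebSahi2021, Prop. 3.3] -/
theorem sahiE_fin_cons (μ : α → ℝ) (n : ℕ) (a : α → ℝ) (g : Fin (n + 1) → α → ℝ) :
    sahiE μ (n + 2) (Fin.cons a g : Fin (n + 2) → α → ℝ) =
      (∑ i : Fin (n + 1), sahiE μ (n + 1) (update g i (g i * a))) - sahiE μ (n + 1) g * ex μ a := by
  rw [sahiE_succ_succ, Fin.tail_cons, Fin.cons_zero]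

/-- A transposition of two tail indices, read through `Fin.cons`. [folklore] -/
theorem comp_swap_succ_succ {β : Type*} {m : ℕ} (g : Fin (m + 2) → β) (x y : Fin (m + 1)) :
    (fun i => g (Equiv.swap x.succ y.succ i)) =
      (Fin.cons (g 0) (fun j => Fin.tail g (Equiv.swap x y j)) : Fin (m + 2) → β) := by
  funext i
  refine Fin.cases ?_ (fun j => ?_) i
  · rw [Fin.cons_zero, Equiv.swap_apply_of_ne_of_ne (Fin.succ_ne_zero x).symm (Fin.succ_ne_zero y).symm]
  · rw [Fin.cons_succ, Fin.succ_injective _ |>.swap_apply]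
    rfl

/-- The head transposition `(0 1)`, read through a double `Fin.cons`. [folklore] -/
theorem comp_swap_zero_one {β : Type*} {m : ℕ} (g : Fin (m + 3) → β) :
    (fun i => g (Equiv.swap 0 1 i)) =
      (Fin.cons (g 1) (Fin.cons (g 0) (Fin.tail (Fin.tail g)) : Fin (m + 2) → β) : Fin (m + 3) → β) := by
  funext i
  refine Fin.cases ?_ (fun j => ?_) i
  · simp
  · refine Fin.cases ?_ (fun k => ?_) j
    · simp
    · have h1 : (1 : Fin (m + 3)) = Fin.succ 0 := rfl
      have hk : k.succ.succ ≠ (1 : Fin (m + 3)) := by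
        rw [h1]
        exact fun h => Fin.succ_ne_zero _ (Fin.succ_injective _ h)
      rw [Fin.cons_succ, Fin.cons_succ, Equiv.swap_apply_of_ne_of_ne (Fin.succ_ne_zero _) hk]
      rfl

/-- A tuple is the double `cons` of its first two entries and its double tail. [folklore] -/
theorem eq_cons_cons {β : Type*} {m : ℕ} (g : Fin (m + 3) → β) :
    g = (Fin.cons (g 0) (Fin.cons (g 1) (Fin.tail (Fin.tail g)) : Fin (m + 2) → β) : Fin (m + 3) → β) := by
  conv_lhs => rw [← Fin.cons_self_tail g, ← Fin.cons_self_tail (Fin.tail g)]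
  rfl

/-! ### (A) permuting the tail, (B) swapping the heads -/

/-- (A) Permuting the tail slots does not change `E_{n+2}`, given symmetry of `E_{n+1}`. [folklore] -/
theorem sahiE_cons_comp_perm (μ : α → ℝ) (n : ℕ)
    (ih : ∀ (τ : Equiv.Perm (Fin (n + 1))) (g : Fin (n + 1) → α → ℝ),
      sahiE μ (n + 1) (fun i => g (τ i)) = sahiE μ (n + 1) g)
    (a : α → ℝ) (g : Fin (n + 1) → α → ℝ) (τ : Equiv.Perm (Fin (n + 1))) :
    sahiE μ (n + 2) (Fin.cons a (fun i => g (τ i)) : Fin (n + 2) → α → ℝ) =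
      sahiE μ (n + 2) (Fin.cons a g : Fin (n + 2) → α → ℝ) := by
  rw [sahiE_fin_cons, sahiE_fin_cons, ih τ g]
  congr 1
  have hupd : ∀ i : Fin (n + 1), update (fun j => g (τ j)) i (g (τ i) * a) =
      fun j => update g (τ i) (g (τ i) * a) (τ j) := by
    intro i
    have h := update_comp_equiv g τ (τ i) (g (τ i) * a)
    rw [Equiv.symm_apply_apply] at h
    exact h.symm
  simp_rw [hupd, ih]
  exact Equiv.sum_comp τ (fun i => sahiE μ (n + 1) (update g i (g i * a)))

/-- (B) Swapping the two head slots does not change `E_{n+3}` (double expansion of the recursion).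
[folklore] -/
theorem sahiE_cons_cons_comm (μ : α → ℝ) (n : ℕ) (a b : α → ℝ) (r : Fin (n + 1) → α → ℝ) :
    sahiE μ (n + 3) (Fin.cons a (Fin.cons b r : Fin (n + 2) → α → ℝ) : Fin (n + 3) → α → ℝ) =
      sahiE μ (n + 3) (Fin.cons b (Fin.cons a r : Fin (n + 2) → α → ℝ) : Fin (n + 3) → α → ℝ) := by
  have key : ∀ a b : α → ℝ,
      sahiE μ (n + 3) (Fin.cons a (Fin.cons b r : Fin (n + 2) → α → ℝ) : Fin (n + 3) → α → ℝ) =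
        ((∑ k, sahiE μ (n + 1) (update r k (r k * (b * a)))) - sahiE μ (n + 1) r * ex μ (b * a))
        + (∑ j, ∑ k, sahiE μ (n + 1) (update (update r j (r j * a)) k (update r j (r j * a) k * b)))
        - (∑ j, sahiE μ (n + 1) (update r j (r j * a))) * ex μ b
        - (∑ k, sahiE μ (n + 1) (update r k (r k * b))) * ex μ a
        + sahiE μ (n + 1) r * ex μ b * ex μ a := by
    intro a b
    rw [sahiE_fin_cons, Fin.sum_univ_succ, Fin.cons_zero, Fin.update_cons_zero]
    simp only [Fin.cons_succ, ← Fin.cons_update, sahiE_fin_cons]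
    rw [Finset.sum_sub_distrib, ← Finset.sum_mul]
    ring
  rw [key, key]
  have hU : ∀ j k : Fin (n + 1), update (update r j (r j * a)) k (update r j (r j * a) k * b) =
      update (update r k (r k * b)) j (update r k (r k * b) j * a) := by
    intro j k
    by_cases hjk : j = k
    · subst hjk
      simp only [update_self, update_idem]
      congr 1
      ring
    · rw [update_of_ne (Ne.symm hjk), update_of_ne hjk, update_comm hjk]
  have hD : (∑ j, ∑ k, sahiE μ (n + 1) (update (update r j (r j * a)) k (update r j (r j * a) k * b))) =
      ∑ j, ∑ k, sahiE μ (n + 1) (update (update r j (r j * b)) k (update r j (r j * b) k * a)) := by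
    rw [Finset.sum_comm]
    exact Finset.sum_congr rfl fun k _ => Finset.sum_congr rfl fun j _ => by rw [hU]
  rw [hD, mul_comm b a]
  ring

/-- Symmetry of `E_2` (= commutativity of the covariance). [cite: LiebSahi2021, eq. (1.1)] -/
theorem sahiE_two_comp_perm (μ : α → ℝ) (σ : Equiv.Perm (Fin 2)) (f : Fin 2 → α → ℝ) :
    sahiE μ 2 (fun i => f (σ i)) = sahiE μ 2 f := by
  rw [sahiE_two_apply, sahiE_two_apply]
  by_cases h : σ 0 = 0
  · have h1 : σ 1 = 1 := by
      have : σ 1 ≠ 0 := fun h' => by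
        have := σ.injective (h'.trans h.symm); exact absurd this (by decide)
      exact Fin.eq_one_of_ne_zero _ this
    rw [h, h1]
  · have h0 : σ 0 = 1 := Fin.eq_one_of_ne_zero _ h
    have h1 : σ 1 = 0 := by
      by_contra h'
      have := Fin.eq_one_of_ne_zero _ h'
      exact absurd (σ.injective (h0.trans this.symm)) (by decide)
    rw [h0, h1, mul_comm (f 1), mul_comm (ex μ (f 1))]

/-! ### (C) transpositions, then all permutations -/

/-- A transposition of two tail indices, given symmetry one level down. [folklore] -/
theorem sahiE_comp_swap_succ (μ : α → ℝ) (n : ℕ)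
    (ih : ∀ (τ : Equiv.Perm (Fin (n + 2))) (g : Fin (n + 2) → α → ℝ),
      sahiE μ (n + 2) (fun i => g (τ i)) = sahiE μ (n + 2) g)
    (x' y' : Fin (n + 2)) (g : Fin (n + 3) → α → ℝ) :
    sahiE μ (n + 3) (fun i => g (Equiv.swap x'.succ y'.succ i)) = sahiE μ (n + 3) g := by
  rw [comp_swap_succ_succ, sahiE_cons_comp_perm μ (n + 1) ih (g 0) (Fin.tail g) (Equiv.swap x' y'),
    Fin.cons_self_tail]

/-- The head transposition `(0 1)`. [folklore] -/
theorem sahiE_comp_swap_zero_one (μ : α → ℝ) (n : ℕ) (g : Fin (n + 3) → α → ℝ) :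
    sahiE μ (n + 3) (fun i => g (Equiv.swap 0 1 i)) = sahiE μ (n + 3) g := by
  rw [comp_swap_zero_one, sahiE_cons_cons_comm, ← eq_cons_cons]

/-- `(0 y) = (1 y)(0 1)(1 y)` for `y ≠ 0` (a conjugation identity in the symmetric group). [folklore] -/
theorem swap_zero_eq_conj {m : ℕ} {y : Fin (m + 3)} (hy0 : y ≠ 0) :
    Equiv.swap (0 : Fin (m + 3)) y = Equiv.swap 1 y * Equiv.swap 0 1 * Equiv.swap 1 y := by
  have h := Equiv.swap_apply_apply (Equiv.swap (1 : Fin (m + 3)) y) 0 1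
  have h01 : (0 : Fin (m + 3)) ≠ 1 := by simp
  rw [Equiv.swap_apply_of_ne_of_ne h01 hy0.symm, Equiv.swap_apply_left, Equiv.swap_inv] at h
  exact h

/-- Transpositions `(0 y)`, given symmetry one level down. [folklore] -/
theorem sahiE_comp_swap_zero (μ : α → ℝ) (n : ℕ)
    (ih : ∀ (τ : Equiv.Perm (Fin (n + 2))) (g : Fin (n + 2) → α → ℝ),
      sahiE μ (n + 2) (fun i => g (τ i)) = sahiE μ (n + 2) g)
    (y : Fin (n + 3)) (g : Fin (n + 3) → α → ℝ) :
    sahiE μ (n + 3) (fun i => g (Equiv.swap 0 y i)) = sahiE μ (n + 3) g := by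
  by_cases hy : y = 0
  · subst hy
    simp only [Equiv.swap_self, Equiv.refl_apply]
  obtain ⟨y', rfl⟩ := Fin.exists_succ_eq.2 hy
  have h1 : (1 : Fin (n + 3)) = (0 : Fin (n + 2)).succ := rfl
  set g₁ : Fin (n + 3) → α → ℝ := fun k => g (Equiv.swap 1 y'.succ k) with hg₁
  set g₂ : Fin (n + 3) → α → ℝ := fun j => g₁ (Equiv.swap 0 1 j) with hg₂
  have hfun : (fun i => g (Equiv.swap 0 y'.succ i)) = fun i => g₂ (Equiv.swap 1 y'.succ i) := by
    funext i
    simp only [hg₂, hg₁, swap_zero_eq_conj hy, Equiv.Perm.mul_apply]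
  have e1 : sahiE μ (n + 3) (fun i => g₂ (Equiv.swap 1 y'.succ i)) = sahiE μ (n + 3) g₂ := by
    rw [h1]; exact sahiE_comp_swap_succ μ n ih 0 y' g₂
  have e2 : sahiE μ (n + 3) g₂ = sahiE μ (n + 3) g₁ := sahiE_comp_swap_zero_one μ n g₁
  have e3 : sahiE μ (n + 3) g₁ = sahiE μ (n + 3) g := by
    rw [hg₁, h1]; exact sahiE_comp_swap_succ μ n ih 0 y' g
  rw [hfun, e1, e2, e3]

/-- Any transposition, given symmetry one level down. [folklore] -/
theorem sahiE_comp_swap (μ : α → ℝ) (n : ℕ)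
    (ih : ∀ (τ : Equiv.Perm (Fin (n + 2))) (g : Fin (n + 2) → α → ℝ),
      sahiE μ (n + 2) (fun i => g (τ i)) = sahiE μ (n + 2) g)
    (x y : Fin (n + 3)) (g : Fin (n + 3) → α → ℝ) :
    sahiE μ (n + 3) (fun i => g (Equiv.swap x y i)) = sahiE μ (n + 3) g := by
  by_cases hx : x = 0
  · subst hx
    exact sahiE_comp_swap_zero μ n ih y g
  by_cases hy : y = 0
  · subst hy
    rw [Equiv.swap_comm]
    exact sahiE_comp_swap_zero μ n ih x g
  obtain ⟨x', rfl⟩ := Fin.exists_succ_eq.2 hx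
  obtain ⟨y', rfl⟩ := Fin.exists_succ_eq.2 hy
  exact sahiE_comp_swap_succ μ n ih x' y' g

/-- **`E_n` is symmetric**: `E_n(f_{σ(0)},…,f_{σ(n−1)}) = E_n(f_0,…,f_{n−1})` for every permutation `σ` —
as is manifest in Sahi's definition `E_n = Σ_{λ ⊢ n} c_λ E_λ` / `Σ_σ (−1)^{C_σ−1} E_σ`; proved here for the
recursive definition. [cite: Sahi2008, eqs. (4)–(7) (p. 211); LiebSahi2021, Def. 3.1] -/
theorem sahiE_comp_perm (μ : α → ℝ) : ∀ (n : ℕ) (σ : Equiv.Perm (Fin n)) (f : Fin n → α → ℝ),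
    sahiE μ n (fun i => f (σ i)) = sahiE μ n f
  | 0, σ, f => by simp [sahiE]
  | 1, σ, f => by
    have : (fun i => f (σ i)) = f := funext fun i => by rw [Subsingleton.elim (σ i) i]
    rw [this]
  | 2, σ, f => sahiE_two_comp_perm μ σ f
  | n + 3, σ, f => by
    induction σ using Equiv.Perm.swap_induction_on generalizing f with
    | one => rfl
    | swap_mul τ x y _ ih =>
      have e1 : sahiE μ (n + 3) (fun i => f ((Equiv.swap x y * τ) i)) =
          sahiE μ (n + 3) (fun i => (fun j => f (Equiv.swap x y j)) (τ i)) := by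
        simp only [Equiv.Perm.mul_apply]
      rw [e1, ih (fun j => f (Equiv.swap x y j))]
      exact sahiE_comp_swap μ n (sahiE_comp_perm μ (n + 2)) x y f

/-! ### Last-slot forms (the verbatim slot order of the sources) -/

/-- **Lieb–Sahi's recursion, verbatim slot order**: `E_n(f^1,…,f^{n−1},f) = e_1 + ⋯ + e_{n−1} − e_n` with
`e_i = E_{n−1}(f^1,…,f^i f,…,f^{n−1})`, `e_n = E_{n−1}(f^1,…,f^{n−1})·E(f)`.
[cite: LiebSahi2021, Prop. 3.3] -/
theorem sahiE_snoc (μ : α → ℝ) (n : ℕ) (g : Fin (n + 1) → α → ℝ) (f : α → ℝ) :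
    sahiE μ (n + 2) (Fin.snoc g f : Fin (n + 2) → α → ℝ) =
      (∑ i : Fin (n + 1), sahiE μ (n + 1) (update g i (g i * f))) - sahiE μ (n + 1) g * ex μ f := by
  rw [Fin.snoc_eq_cons_rotate, sahiE_comp_perm, sahiE_fin_cons]

/-- **Branching, verbatim slot order** [Sahi2008, Thm. 6]: `E_n(f_1,…,f_{n−1},1) = (n−2)·E_{n−1}(f_1,…,f_{n−1})`
(here `n ↦ n + 2`), for a probability weight. [cite: Sahi2008, Thm. 6 (p. 214); LiebSahi2021, eq. (1.3)] -/
theorem sahiE_snoc_one {μ : α → ℝ} (hμ : ∑ x, μ x = 1) (n : ℕ) (g : Fin (n + 1) → α → ℝ) :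
    sahiE μ (n + 2) (Fin.snoc g 1 : Fin (n + 2) → α → ℝ) = n * sahiE μ (n + 1) g := by
  rw [Fin.snoc_eq_cons_rotate, sahiE_comp_perm]
  exact sahiE_succ_succ_of_head_eq_one hμ _ rfl

/-- `SahiPositive` is invariant under reindexing the family by a permutation (trivial bookkeeping, recorded for
users who state rows in a different slot order). [folklore] -/
theorem sahiE_nonneg_comp_perm_iff (μ : α → ℝ) {n : ℕ} (σ : Equiv.Perm (Fin n)) (f : Fin n → α → ℝ) :
    0 ≤ sahiE μ n (fun i => f (σ i)) ↔ 0 ≤ sahiE μ n f := by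
  rw [sahiE_comp_perm]

end Literature.Combinatorics.Sahi2008
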